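import Summits.QuantumAdvantage.QuantumAdvantage.Theorems.AbelianDialD

/-! # AbelianDialE — part 5/5 of the landing twins of NODE «AbelianDial» (decomp-qadv lens-2; node file
`g23/AbelianDial.lean`, sha256 4845a3792d6530ec…; generator `g23/tree/gen_twins.py`: namespace
`Theses.AbelianDial` → `Theorems.AbelianDial`, cut at declaration boundaries, docstrings added where missing, nothing else).
Content: §6 ★ the TWIN COINCIDENCE LAW — `leven_orbF`, `pm_addResp`, `coin_loss_count`, the fix-up `cfix`, `univ_le_coin`,
`pm_loss_count`, `pmLoss : n ≥ 2¹⁵ → #{odd winners of the twin family} ≤ (1 − n⁻¹)·2^{n−1}`, `PmLoss3` (B's format, `C = 1`). -/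

set_option linter.dupNamespace false
noncomputable section
open scoped Classical

namespace Summit.QuantumAdvantage.QuantumAdvantage.Theorems.AbelianDial
open Finset
open Literature.Computability.QuantumComplexity Literature.Computability.QuantumComplexity.RingHLF
open Literature.Computability.MetaComplexity Literature.Computability.MetaComplexity.Smolensky
open Summit.QuantumAdvantage.AdviceFreeQNC0
open Summit.QuantumAdvantage.QuantumAdvantage.Theorems.AnchorDial (outB dev orbF oddZeros_orbF orbF_apply_of_far
  card_filter_orbF card_odd_ge loss_shape_mono)
open Summit.QuantumAdvantage.QuantumAdvantage.Theorems.HolonomyDial (tPoly tPoly_apply tPoly_mem xorP xorP_mem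
  xorP_apply_bool indP indP_apply indP_mem mono_singleton_apply)
open Summit.QuantumAdvantage.QuantumAdvantage.Theorems.StabilizerDial (apIdx apStrat apStrat_mem bitP bitP_apStrat pad
  pad_mem rel_pad_iff StabFew outB_pad_pad outB_pad_congr bitP_gsum gsum gsum_mem deg_gsum dev_congr)
open Summit.QuantumAdvantage.QuantumAdvantage.Theorems.SparsityDial (real_loss_of_frac stabFew_mono_mr one_le_logpow)
open Summit.QuantumAdvantage.QuantumAdvantage.Theorems.ResponseDial (mem_dev_apStrat dev_pad_zero
  not_polylogSparse_of_agree AddResp additive_loss_count lodd lodd_mem lodd_eq_sum lodd_orbF oddSite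
  oddSite_val oddSite_odd card_exists_orbF_le fibre_le_pow orbF_apply)
open Summit.QuantumAdvantage.QuantumAdvantage.Theorems.CounterDial (bsel mem_iff_bsel)
open Summit.QuantumAdvantage.QuantumAdvantage.Theorems.CounterDial (lin CounterForm StabCounter Dark dw dw_apply_of_far
  oddZeros_dw dark_loss_count)
open Summit.QuantumAdvantage.QuantumAdvantage.Theorems.BlindDial (apIdx_val_first)

variable {N : ℕ}

/-! ## §6  ★ THE TWIN COINCIDENCE LAW — the twin family LOSES (a DECIDED rung of the special piece)

On the inputs whose five site pairs `{20+4i, 21+4i}` carry EQUAL bits and whose two counters AGREE (`Σ_odd ≡ Σ_even`),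
every pair-flip moves both counters by the same amount, so the twin gate stays dark (`[L ≡ 0] ⊕ [L ≡ 0] = 0`) along the
whole 32-point orbit while the pointer positions are untouched: the deviation set is FROZEN on the orbit (additive
response with empty response sets) and the tree's additive-response orbit law makes an orbit point lose. A fix-up
changing ten ODD cells maps every input to such a coincidence input ⇒ `#odd ≤ 2¹⁵ · #odd-losers` ⇒ B's loss format. -/

/-- the flip sites `20 + 4i` (pair `i` = cells `{20+4i, 21+4i}`). -/
def bS : Fin 5 → ℕ := fun i => 20 + 4 * i.val

/-- the five sites `20 + 4i` are pairwise separated (`bS i + 2 ≤ bS j` for `i < j`). -/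
theorem bS_sep : ∀ i j : Fin 5, i < j → bS i + 2 ≤ bS j := fun i j h => by
  have := Fin.lt_def.1 h; unfold bS; omega

/-- the five sites fit below `N` once `50 ≤ N` (`bS i + 3 ≤ N`). -/
theorem bS_le (hN : 50 ≤ N) : ∀ i : Fin 5, bS i + 3 ≤ N := fun i => by unfold bS; have := i.isLt; omega

/-- the even cell of the `i`-th flipped pair (generic sites; companion of the tree's `oddSite`). -/
def evenSite {b : Fin 5 → ℕ} (hbN : ∀ i, b i + 3 ≤ N) (i : Fin 5) : Fin N :=
  ⟨if b i % 2 = 0 then b i else b i + 1, by have := hbN i; split_ifs <;> omega⟩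

/-- the even-indexed cell of a site pair has even index. -/
theorem evenSite_even {b : Fin 5 → ℕ} (hbN : ∀ i, b i + 3 ≤ N) (i : Fin 5) : (evenSite hbN i).val % 2 = 0 := by
  unfold evenSite; dsimp only; split_ifs <;> omega

/-- the even-indexed cell of pair `i` is `b i` or `b i + 1`. -/
theorem evenSite_val {b : Fin 5 → ℕ} (hbN : ∀ i, b i + 3 ≤ N) (i : Fin 5) :
    (evenSite hbN i).val = b i ∨ (evenSite hbN i).val = b i + 1 := by
  unfold evenSite; dsimp only; split_ifs <;> simp

/-- **the even counter along a pair-flip orbit** (companion of the tree's `lodd_orbF`). -/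
theorem leven_orbF {b : Fin 5 → ℕ} (hb : ∀ i j : Fin 5, i < j → b i + 2 ≤ b j) (hbN : ∀ i, b i + 3 ≤ N)
    (ε : Fin 5 → Bool) (x : Fin N → Bool) :
    (leven : CubeFn (ZMod 3) N) (orbF b ε x) =
      (leven : CubeFn (ZMod 3) N) x +
        ∑ i ∈ (univ : Finset (Fin 5)).filter (fun i => ε i = true), Theorems.ResponseDial.sgn3 (x (evenSite hbN i)) := by
  rw [leven_eq_sum, leven_eq_sum]
  have hpt : ∀ j ∈ (univ : Finset (Fin N)).filter (fun j => j.val % 2 = 0),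
      (if orbF b ε x j then (1 : ZMod 3) else 0) =
        (if x j then (1 : ZMod 3) else 0) +
          (if (∃ i, ε i = true ∧ (j.val = b i ∨ j.val = b i + 1)) then Theorems.ResponseDial.sgn3 (x j) else 0) := by
    intro j _
    rw [orbF_apply hb ε x j]
    by_cases h : ∃ i, ε i = true ∧ (j.val = b i ∨ j.val = b i + 1)
    · rw [if_pos h, if_pos h]; unfold Summit.QuantumAdvantage.QuantumAdvantage.Theorems.ResponseDial.sgn3
      cases x j <;> decide
    · rw [if_neg h, if_neg h, add_zero]
  rw [sum_congr rfl hpt, sum_add_distrib]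
  congr 1
  have hset : ((univ : Finset (Fin N)).filter (fun j => j.val % 2 = 0)).filter
      (fun j => ∃ i, ε i = true ∧ (j.val = b i ∨ j.val = b i + 1)) =
        ((univ : Finset (Fin 5)).filter (fun i => ε i = true)).image (evenSite hbN) := by
    ext j
    simp only [mem_filter, mem_univ, true_and, mem_image]
    constructor
    · rintro ⟨hev, i, hi, hj⟩
      refine ⟨i, hi, Fin.ext ?_⟩
      have h1 := evenSite_val hbN i
      have h2 := evenSite_even hbN i
      rcases hj with hj | hj <;> rcases h1 with h1 | h1 <;> omega
    · rintro ⟨i, hi, rfl⟩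
      exact ⟨evenSite_even hbN i, i, hi, evenSite_val hbN i⟩
  rw [← sum_filter, hset, sum_image]
  intro i₁ hi₁ i₂ hi₂ heq
  by_contra hne
  have hv := congrArg Fin.val heq
  have h1 := evenSite_val hbN i₁
  have h2 := evenSite_val hbN i₂
  rcases lt_or_gt_of_ne hne with hlt | hlt
  · have := hb i₁ i₂ hlt; omega
  · have := hb i₂ i₁ hlt; omega

/-- site cell `20 + 4i` (even), its copy cell `21 + 4i` (odd), adjuster cell `41 + 2m` (odd). -/
def scell (hN : 50 ≤ N) (i : Fin 5) : Fin N := ⟨20 + 4 * i.val, by omega⟩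
/-- the COPY cell of site pair `i`: the odd cell `21 + 4i` (it receives the bit of its even partner `20 + 4i` under the fix-up). -/
def ccell (hN : 50 ≤ N) (i : Fin 5) : Fin N := ⟨21 + 4 * i.val, by omega⟩
/-- the `m`-th ADJUSTER cell: the odd cell `41 + 2m`, `m < 5` (set by the fix-up to repair `Σ_odd` and the zero parity). -/
def acell (hN : 50 ≤ N) (m : Fin 5) : Fin N := ⟨41 + 2 * m.val, by omega⟩

/-- for the sites `bS`, the odd cell of pair `i` is the copy cell `ccell i = 21 + 4i`. -/
theorem oddSite_bS (hN : 50 ≤ N) (i : Fin 5) : oddSite (bS_le hN) i = ccell hN i :=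
  Fin.ext (by
    unfold Summit.QuantumAdvantage.QuantumAdvantage.Theorems.ResponseDial.oddSite ccell bS
    dsimp only; split_ifs <;> omega)

/-- for the sites `bS`, the even cell of pair `i` is the site cell `scell i = 20 + 4i`. -/
theorem evenSite_bS (hN : 50 ≤ N) (i : Fin 5) : evenSite (bS_le hN) i = scell hN i :=
  Fin.ext (by unfold evenSite scell bS; dsimp only; split_ifs <;> omega)

/-- the COINCIDENCE inputs: equal bits on each site pair, agreeing counters. -/
def Coin (hN : 50 ≤ N) (x : Fin N → Bool) : Prop :=
  (∀ i : Fin 5, x (scell hN i) = x (ccell hN i)) ∧ (lodd : CubeFn (ZMod 3) N) x = (leven : CubeFn (ZMod 3) N) x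

/-- **pointwise law**: on a coincidence input the twin family's deviation set is frozen along the site orbit
(additive response with empty response sets). -/
theorem pm_addResp (hN : 100 ≤ N) (x : Fin N → Bool) (hc : Coin (by omega : 50 ≤ N) x) :
    AddResp bS (fun i : Fin N => pmStrat i) (fun _ => ∅) x := by
  intro ε k
  have he : ((univ.filter fun i : Fin 5 => ε i = true ∧ k ∈ (∅ : Finset (Fin N))).card % 2 = 0) := by simp
  refine Iff.trans ?_ (iff_true_right he).symm
  by_cases hk : 1 ≤ k.val ∧ k.val < N / 2
  · rw [mem_dev_pm_first _ k hk, mem_dev_pm_first _ k hk, orbF_apply_of_far bS ε x (apIdx k) ?_]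
    intro i
    have := apIdx_val_first k hk.2
    unfold bS; omega
  · rw [mem_dev_pm_second _ k hk, mem_dev_pm_second _ k hk]
    have h50 : 50 ≤ N := by omega
    have hL := lodd_orbF bS_sep (bS_le h50) ε x
    have hE := leven_orbF bS_sep (bS_le h50) ε x
    have hsum : (∑ i ∈ (univ : Finset (Fin 5)).filter (fun i => ε i = true),
        Theorems.ResponseDial.sgn3 (x (oddSite (bS_le h50) i))) =
        ∑ i ∈ (univ : Finset (Fin 5)).filter (fun i => ε i = true),
          Theorems.ResponseDial.sgn3 (x (evenSite (bS_le h50) i)) :=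
      sum_congr rfl fun i _ => by rw [oddSite_bS h50, evenSite_bS h50, hc.1 i]
    have h1 : (lodd : CubeFn (ZMod 3) N) (orbF bS ε x) = (leven : CubeFn (ZMod 3) N) (orbF bS ε x) := by
      rw [hL, hE, hc.2, hsum]
    unfold pmBit
    rw [h1, hc.2, Bool.xor_self, Bool.xor_self]

/-- counting form of the pointwise law: `#{odd ∧ Coin} ≤ 32 · #odd-losers`. -/
theorem coin_loss_count (hN : 100 ≤ N) :
    (univ.filter fun x : Fin N → Bool => OddZeros x ∧ Coin (by omega : 50 ≤ N) x).card ≤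
      32 * (univ.filter fun x : Fin N → Bool => OddZeros x ∧ ¬ Rel x (outB (fun i : Fin N => pmStrat i) x)).card := by
  refine le_trans (card_le_card fun x hx => ?_)
    (additive_loss_count (by omega) bS_sep (bS_le (by omega)) (fun i : Fin N => pmStrat i))
  rw [mem_filter] at hx ⊢
  exact ⟨mem_univ _, hx.2.1, fun _ => ∅, pm_addResp hN x hx.2.2⟩

/-! ### the fix-up: every input is `10` odd cells away from an odd coincidence input -/

/-- the coincidence-cell map `ccell` is injective. -/
theorem ccell_injective (hN : 50 ≤ N) : Function.Injective (ccell hN) := fun i j h => by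
  have h1 := congrArg Fin.val h; exact Fin.ext (by simp only [ccell, Fin.val_mk] at h1; omega)

/-- distinct indices give distinct adjuster cells. -/
theorem acell_injective (hN : 50 ≤ N) : Function.Injective (acell hN) := fun i j h => by
  have h1 := congrArg Fin.val h; exact Fin.ext (by simp only [acell, Fin.val_mk] at h1; omega)

/-- the copy cells, the adjuster cells, the touched cells. -/
def Tc (hN : 50 ≤ N) : Finset (Fin N) := univ.image (ccell hN)
/-- the set of the five adjuster cells. -/
def Ta (hN : 50 ≤ N) : Finset (Fin N) := univ.image (acell hN)
/-- the TEN cells touched by the fix-up: the five copy cells and the five adjuster cells. -/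
def TT (hN : 50 ≤ N) : Finset (Fin N) := Tc hN ∪ Ta hN

/-- an adjuster cell is not a copy cell. -/
theorem acell_notMem_Tc (hN : 50 ≤ N) (m : Fin 5) : acell hN m ∉ Tc hN := fun h => by
  obtain ⟨i, -, hi⟩ := mem_image.1 h
  have h1 := congrArg Fin.val hi; simp only [ccell, acell, Fin.val_mk] at h1; omega

/-- a site cell `20 + 4i` is not touched by the fix-up. -/
theorem scell_notMem_TT (hN : 50 ≤ N) (i : Fin 5) : scell hN i ∉ TT hN := fun h => by
  rcases mem_union.1 h with h | h
  · obtain ⟨j, -, hj⟩ := mem_image.1 h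
    have h1 := congrArg Fin.val hj; simp only [ccell, scell, Fin.val_mk] at h1; omega
  · obtain ⟨m, -, hm⟩ := mem_image.1 h
    have h1 := congrArg Fin.val hm; simp only [acell, scell, Fin.val_mk] at h1; omega

/-- copy cells and adjuster cells are disjoint. -/
theorem disjoint_Tc_Ta (hN : 50 ≤ N) : Disjoint (Tc hN) (Ta hN) :=
  disjoint_right.2 fun j hj hc => by
    obtain ⟨m, -, rfl⟩ := mem_image.1 hj
    exact acell_notMem_Tc hN m hc

/-- the fix-up touches exactly ten cells. -/
theorem TT_card (hN : 50 ≤ N) : (TT hN).card = 10 := by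
  unfold TT
  rw [card_union_of_disjoint (disjoint_Tc_Ta hN), Tc, Ta, card_image_of_injective _ (ccell_injective hN),
    card_image_of_injective _ (acell_injective hN), card_univ, Fintype.card_fin]

/-- every touched cell has odd index. -/
theorem TT_odd (hN : 50 ≤ N) : ∀ j ∈ TT hN, j.val % 2 = 1 := fun j hj => by
  rcases mem_union.1 hj with h | h
  · obtain ⟨i, -, rfl⟩ := mem_image.1 h; simp only [ccell]; omega
  · obtain ⟨m, -, rfl⟩ := mem_image.1 h; simp only [acell]; omega

/-- the touched cells are odd cells. -/
theorem TT_sub_odd (hN : 50 ≤ N) : TT hN ⊆ univ.filter fun j : Fin N => j.val % 2 = 1 :=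
  fun j hj => mem_filter.2 ⟨mem_univ _, TT_odd hN j hj⟩

/-- splitting a sum over a set containing the touched cells. -/
theorem sum_split {M : Type*} [AddCommMonoid M] (hN : 50 ≤ N) (S : Finset (Fin N)) (hS : TT hN ⊆ S) (g : Fin N → M) :
    ∑ j ∈ S, g j = ∑ j ∈ S \ TT hN, g j + ((∑ i : Fin 5, g (ccell hN i)) + ∑ m : Fin 5, g (acell hN m)) := by
  have e : S \ TT hN ∪ TT hN = S := sdiff_union_of_subset hS
  calc ∑ j ∈ S, g j = ∑ j ∈ S \ TT hN ∪ TT hN, g j := by rw [e]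
    _ = ∑ j ∈ S \ TT hN, g j + ∑ j ∈ TT hN, g j := sum_union disjoint_sdiff_self_left
    _ = _ := by
        unfold TT
        rw [sum_union (disjoint_Tc_Ta hN), Tc, Ta, sum_image fun i _ j _ h => ccell_injective hN h,
          sum_image fun i _ j _ h => acell_injective hN h]

/-- the quantities steering the fix-up: ones of `x` on the odd cells off `T`, on the site cells; zeros off `T`, on the
site cells. -/
def sOff (hN : 50 ≤ N) (x : Fin N → Bool) : ZMod 3 :=
  ∑ j ∈ (univ.filter fun j : Fin N => j.val % 2 = 1) \ TT hN, (if x j = true then (1 : ZMod 3) else 0)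
/-- `Σ_i [x (scell i)]` in `Z₃`: what the five copy cells contribute to `Σ_odd` AFTER the fix-up. -/
def sCp (hN : 50 ≤ N) (x : Fin N → Bool) : ZMod 3 := ∑ i : Fin 5, (if x (scell hN i) = true then (1 : ZMod 3) else 0)
/-- the number of zeros of `x` off the touched cells `TT`. -/
def zOff (hN : 50 ≤ N) (x : Fin N → Bool) : ℕ := ∑ j ∈ univ \ TT hN, (if x j = false then 1 else 0)
/-- the number of zeros among the five site cells `scell i` (= the zeros the copy cells carry after the fix-up). -/
def cz (hN : 50 ≤ N) (x : Fin N → Bool) : ℕ := ∑ i : Fin 5, (if x (scell hN i) = false then 1 else 0)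
/-- the residue the adjusters must supply, and their number `s ∈ {0,…,5}` (residue mod 3, parity mod 2). -/
def Dfix (hN : 50 ≤ N) (x : Fin N → Bool) : ZMod 3 := (leven : CubeFn (ZMod 3) N) x - sOff hN x - sCp hN x
/-- the number `s ≤ 5` of adjuster cells the fix-up sets to one: the representative mod `6` that is `≡ Dfix (mod 3)` and makes the total zero count odd (CRT). -/
def sfix (hN : 50 ≤ N) (x : Fin N → Bool) : ℕ :=
  (Dfix hN x).val + 3 * (((Dfix hN x).val + zOff hN x + cz hN x) % 2)

/-- `sfix x ≤ 5`. -/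
theorem sfix_le (hN : 50 ≤ N) (x : Fin N → Bool) : sfix hN x ≤ 5 := by
  unfold sfix; have := ZMod.val_lt (Dfix hN x); omega

/-- `sfix x ≡ Dfix x (mod 3)`. -/
theorem sfix_cast (hN : 50 ≤ N) (x : Fin N → Bool) : ((sfix hN x : ℕ) : ZMod 3) = Dfix hN x := by
  unfold sfix
  rw [Nat.cast_add, Nat.cast_mul, ZMod.natCast_zmod_val]
  have h3 : ((3 : ℕ) : ZMod 3) = 0 := by decide
  rw [h3, zero_mul, add_zero]

/-- **the fix-up map**: copy each site bit into its odd neighbour, then set the five odd adjuster cells. -/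
def cfix (hN : 50 ≤ N) (x : Fin N → Bool) (j : Fin N) : Bool :=
  if j ∈ Tc hN then x ⟨j.val - 1, by omega⟩
  else if j ∈ Ta hN then decide ((j.val - 41) / 2 < sfix hN x) else x j

/-- the fix-up does not touch cells off `TT`. -/
theorem cfix_off (hN : 50 ≤ N) (x : Fin N → Bool) (j : Fin N) (hj : j ∉ TT hN) : cfix hN x j = x j := by
  unfold cfix; unfold TT at hj; rw [mem_union, not_or] at hj; rw [if_neg hj.1, if_neg hj.2]

/-- after the fix-up the copy cell `21 + 4i` carries the bit of its site partner `20 + 4i`. -/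
theorem cfix_ccell (hN : 50 ≤ N) (x : Fin N → Bool) (i : Fin 5) : cfix hN x (ccell hN i) = x (scell hN i) := by
  have hm : ccell hN i ∈ Tc hN := mem_image_of_mem _ (mem_univ i)
  unfold cfix; rw [if_pos hm]
  congr 1; exact Fin.ext (by simp only [ccell, scell]; omega)

/-- after the fix-up the `m`-th adjuster cell is one iff `m < sfix x`. -/
theorem cfix_acell (hN : 50 ≤ N) (x : Fin N → Bool) (m : Fin 5) :
    cfix hN x (acell hN m) = decide (m.val < sfix hN x) := by
  have hm : acell hN m ∈ Ta hN := mem_image_of_mem _ (mem_univ m)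
  unfold cfix; rw [if_neg (acell_notMem_Tc hN m), if_pos hm]
  congr 1; simp only [acell]
  apply propext; constructor <;> intro h <;> omega

/-- the fix-up leaves the site cells `20 + 4i` unchanged. -/
theorem cfix_scell (hN : 50 ≤ N) (x : Fin N → Bool) (i : Fin 5) : cfix hN x (scell hN i) = x (scell hN i) :=
  cfix_off hN x _ (scell_notMem_TT hN i)

/-- `Σ_{m<5} [m < s] = s` in `Z₃` (for `s ≤ 5`). -/
theorem adj_sum3 (s : ℕ) (hs : s ≤ 5) : (∑ m : Fin 5, if m.val < s then (1 : ZMod 3) else 0) = (s : ZMod 3) := by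
  rw [Fin.sum_univ_five]
  interval_cases s <;> decide

/-- `#{m < 5 : ¬ m < s} = 5 − s` (for `s ≤ 5`). -/
theorem adj_sum0 (s : ℕ) (hs : s ≤ 5) : (∑ m : Fin 5, if ¬ (m.val < s) then 1 else 0) = 5 - s := by
  rw [Fin.sum_univ_five]
  interval_cases s <;> decide

/-- the odd counter of the fixed input. -/
theorem lodd_cfix (hN : 50 ≤ N) (x : Fin N → Bool) :
    (lodd : CubeFn (ZMod 3) N) (cfix hN x) = sOff hN x + (sCp hN x + (sfix hN x : ZMod 3)) := by
  have h1 : (∑ j ∈ (univ.filter fun j : Fin N => j.val % 2 = 1) \ TT hN,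
      (if cfix hN x j = true then (1 : ZMod 3) else 0)) = sOff hN x :=
    sum_congr rfl fun j hj => by rw [cfix_off hN x j (mem_sdiff.1 hj).2]
  have h2 : (∑ i : Fin 5, if cfix hN x (ccell hN i) = true then (1 : ZMod 3) else 0) = sCp hN x :=
    sum_congr rfl fun i _ => by rw [cfix_ccell]
  have h3 : (∑ m : Fin 5, if cfix hN x (acell hN m) = true then (1 : ZMod 3) else 0) = (sfix hN x : ZMod 3) := by
    rw [← adj_sum3 (sfix hN x) (sfix_le hN x)]
    exact sum_congr rfl fun m _ => by rw [cfix_acell]; simp only [decide_eq_true_eq]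
  rw [lodd_eq_sum, sum_split hN _ (TT_sub_odd hN), h1, h2, h3]

/-- the even counter of the fixed input is unchanged (only odd cells move). -/
theorem leven_cfix (hN : 50 ≤ N) (x : Fin N → Bool) :
    (leven : CubeFn (ZMod 3) N) (cfix hN x) = (leven : CubeFn (ZMod 3) N) x := by
  rw [leven_eq_sum, leven_eq_sum]
  refine sum_congr rfl fun j hj => ?_
  rw [cfix_off hN x j (fun h => by have := TT_odd hN j h; have := (mem_filter.1 hj).2; omega)]

/-- the number of zeros of the fixed input. -/
theorem zeros_cfix (hN : 50 ≤ N) (x : Fin N → Bool) :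
    (univ.filter fun j : Fin N => cfix hN x j = false).card = zOff hN x + (cz hN x + (5 - sfix hN x)) := by
  have h1 : (∑ j ∈ univ \ TT hN, (if cfix hN x j = false then 1 else 0)) = zOff hN x :=
    sum_congr rfl fun j hj => by rw [cfix_off hN x j (mem_sdiff.1 hj).2]
  have h2 : (∑ i : Fin 5, if cfix hN x (ccell hN i) = false then 1 else 0) = cz hN x :=
    sum_congr rfl fun i _ => by rw [cfix_ccell]
  have h3 : (∑ m : Fin 5, if cfix hN x (acell hN m) = false then 1 else 0) = 5 - sfix hN x := by
    rw [← adj_sum0 (sfix hN x) (sfix_le hN x)]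
    exact sum_congr rfl fun m _ => by rw [cfix_acell]; simp only [decide_eq_false_iff_not]
  rw [card_filter, sum_split hN univ (subset_univ _), h1, h2, h3]

/-- the fixed input is in the odd class … -/
theorem cfix_odd (hN : 50 ≤ N) (x : Fin N → Bool) : OddZeros (cfix hN x) := by
  unfold OddZeros
  rw [zeros_cfix]
  have hv := ZMod.val_lt (Dfix hN x)
  unfold sfix
  omega

/-- … and is a coincidence input. -/
theorem cfix_coin (hN : 50 ≤ N) (x : Fin N → Bool) : Coin hN (cfix hN x) := by
  refine ⟨fun i => by rw [cfix_ccell, cfix_scell], ?_⟩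
  rw [leven_cfix, lodd_cfix, sfix_cast]
  unfold Dfix; ring

/-- density of the odd coincidence inputs: `2ⁿ ≤ 2¹⁰ · #{odd ∧ Coin}`. -/
theorem univ_le_coin (hN : 50 ≤ N) :
    (univ : Finset (Fin N → Bool)).card ≤ 1024 * (univ.filter fun x : Fin N → Bool => OddZeros x ∧ Coin hN x).card := by
  refine card_le_mul_card_image_of_maps_to (f := cfix hN)
    (fun x _ => mem_filter.2 ⟨mem_univ _, cfix_odd hN x, cfix_coin hN x⟩) 1024 (fun y _ => ?_)
  refine (fibre_le_pow (TT hN) (cfix hN) (fun x j hj => cfix_off hN x j hj) y _).trans ?_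
  rw [TT_card]; norm_num

/-- **★ THE TWIN LAW (counting form)**: `#odd ≤ 2¹⁵ · #odd-losers` for the twin family (`N ≥ 100`). -/
theorem pm_loss_count (hN : 100 ≤ N) :
    (univ.filter fun x : Fin N → Bool => OddZeros x).card ≤
      32768 * (univ.filter fun x : Fin N → Bool => OddZeros x ∧ ¬ Rel x (outB (fun i : Fin N => pmStrat i) x)).card :=
  calc (univ.filter fun x : Fin N → Bool => OddZeros x).card
      ≤ (univ : Finset (Fin N → Bool)).card := card_filter_le _ _
    _ ≤ 1024 * (univ.filter fun x : Fin N → Bool => OddZeros x ∧ Coin (by omega : 50 ≤ N) x).card := univ_le_coin (by omega)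
    _ ≤ 1024 * (32 * (univ.filter fun x : Fin N → Bool =>
          OddZeros x ∧ ¬ Rel x (outB (fun i : Fin N => pmStrat i) x)).card) := Nat.mul_le_mul_left _ (coin_loss_count hN)
    _ = 32768 * (univ.filter fun x : Fin N → Bool =>
          OddZeros x ∧ ¬ Rel x (outB (fun i : Fin N => pmStrat i) x)).card := by ring

/-- **★ THE TWIN LAW**: for `n ≥ 2¹⁵` the parity-mixed twin family wins on at most a `(1 − n⁻¹)` fraction of the odd
class — the lineage's standing «twin-XOR» exemplar (NODE-g22, IDEA-NEEDED) is DECIDED: it LOSES. -/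
theorem pmLoss {n : ℕ} (hn : 32768 ≤ n) :
    ((univ.filter fun x : Fin n → Bool => OddZeros x ∧ Rel x (fun i => decide (pmStrat i x = 1))).card : ℝ) ≤
      (1 - 1 / (n : ℝ) ^ 1) * (2 : ℝ) ^ (n - 1) :=
  real_loss_of_frac (M := 32768) (by norm_num) hn (by omega) (fun i : Fin n => pmStrat i) (pm_loss_count (by omega))

/-- the twin law in B's format (`C = 1`), unconditionally in `a, c`: the special piece `AbelianLoss3` holds ON this
inhabitant of its class — a decided rung (the class-level statement stays open). -/
theorem PmLoss3 : ∃ C n₀ : ℕ, ∀ n ≥ n₀,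
    ((univ.filter fun x : Fin n → Bool => OddZeros x ∧ Rel x (fun i => decide (pmStrat i x = 1))).card : ℝ) ≤
      (1 - 1 / (n : ℝ) ^ C) * (2 : ℝ) ^ (n - 1) :=
  ⟨1, 32768, fun _ hn => pmLoss hn⟩

end Summit.QuantumAdvantage.QuantumAdvantage.Theorems.AbelianDial
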